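import Summits.AtomisticToContinuum.Crystallization.Theorems.OverbindingBudgetAffineLadder

/-!
# NODE g79 «CompressedCut», toward the open leaf NS♭₂ — the AFFINE first-shell scale floor and the ONE-STEP SCALE TRANSFER between adjacent affine frames

Route `OverbindingBudget` (Crystallization), crux `RobustDefectLimitWindows` (stmt-AtomisticToContinuum-31280), decomp-a2c lens 4, generation 79,
ADDENDUM 3.  The open leaf of NODE g79 after the first class was proved (`…OverbindingBudgetAffineCompressedCutFirst`) is the AFFINE class
`NearFieldSlackMinSecond 12 (1/25)` («NS♭₂»), whose engine is an explicit short DEVELOPMENT of the `(12, 10⁻⁴, 10⁻³)`-affinely deep ball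
(memo NODE-g79 §5 (a)).  A development has a SCALE half (all sites of the ball live at one scale up to `1 ± O(θ + ε)` per step) and a FRAME
half (adjacent affine frames agree up to a pattern symmetry and `O(θ + ε)`).  This file PROVES the scale half's one-step lemma, potential-free:

* `affFirstShell_scale_floor` — the affine analogue of (F1′): at an affinely framed site `i` (`AffFramed ε θ g`), a site `k ≠ i` at depth `t`
  inside the exhaustive radius has `nn_k ≥ min t (1 − 2θ − 2ε)·nn_i` (the affine image of the `1`-separated pattern is `(1 − 2θ)`-separated).
* `affFramed_scale_transfer` — ONE-STEP SCALE TRANSFER: if `j` and `k ≠ j` are both affinely framed (`θ + ε ≤ 1/50`, `0 ≤ g`) and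
  `dist (y k) (y j) ≤ (1 + θ + ε)·nn_j` (e.g. `k` is a first-shell point of `j`'s frame), then
  `(1 − 2θ − 2ε)/(1 + θ + ε)·nn_j ≤ nn_k` (and trivially `nn_k ≤ (1 + θ + ε)·nn_j`).  Mechanism (the HEMISPHERE TRICK): both two-shell
  patterns contain an antipodal pair `±w` of kissing points (`exists_pm_mem_twoShellPattern`), so `k`'s own frame has a first-shell site `m`
  on `j`'s side of `k` up to `O(θ + ε)`: `dist (y m) (y j)² ≤ r² + 2(θ + ε)·nn_k·D + D²` with `r = dist (y m) (y k) ≤ (1 + θ + ε)·nn_k`,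
  `D = dist (y k) (y j)`; hence `m` lies within `3/2·nn_j` of `j`, is a point of `j`'s frame, and `j`'s affine separation gives
  `r ≥ (1 − 2θ − 2ε)·nn_j`, while `r ≤ (1 + θ + ε)·nn_k`.
* `affFramed_scale_chain` / `_le` / `_record` — iterated along a first-shell chain `j :: l` of affinely framed sites: every scale lies in
  `[λ^{|l|}, (1 + θ + ε)^{|l|}]·nn_j`, `λ = (1 − 2θ − 2ε)/(1 + θ + ε)`; at the record literals and `|l| ≤ 16`: `[237/250, 211/200]·nn_j`.
* Record corollaries at the node literals `(ε, θ, g) = (10⁻⁴, 10⁻³, 1/450)`: `nn_k ≥ 0.9967·nn_j` one step out (`affFramed_scale_transfer_record`),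
  so along first-shell chains of length `n ≤ 16` inside the `12·nn`-ball every scale stays in `[0.948, 1.055]·nn_i` — exactly the coherence
  the far-field obstruction (O3) showed `3/50`-registration does NOT provide.

Deps: tree only (`…OverbindingBudgetAffineLadder` for `AffFramed`; the Literature pattern facts BY NAME).  No `instance`, no `notation`, no new
axioms, 0 sorry.
-/

namespace Summit.AtomisticToContinuum.Crystallization.Theorems.OverbindingBudgetAffineCompressedCutScale

open Literature.Geometry.DiscreteGeometry (nearestDist nearestDist_nonneg nearestDist_le_dist le_nearestDist exists_nearestDist_eq_dist
  fccTwoShellPattern hcpTwoShellPattern one_le_dist_of_mem_fccTwoShellPattern one_le_dist_of_mem_hcpTwoShellPattern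
  norm_of_mem_fccTwoShellPattern norm_of_mem_hcpTwoShellPattern fccKissingPattern hcpKissingPattern fccKissingPattern_subset
  hcpKissingPattern_subset norm_eq_one_of_mem_fccKissingPattern norm_eq_one_of_mem_hcpKissingPattern intVec fccInt hcpInt)
open Summit.AtomisticToContinuum.Crystallization.Theorems.OverbindingBudgetAffineLadder (AffFramed)

variable {N : ℕ}

/-! ## §1  Pattern facts (affine images of the two-shell patterns) -/

/-- Either two-shell pattern is `1`-separated. [Literature `one_le_dist_of_mem_fcc/hcpTwoShellPattern`] -/
private theorem one_le_dist_of_mem_twoShellPattern {P : Finset (EuclideanSpace ℝ (Fin 3))}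
    (hP : P = fccTwoShellPattern ∨ P = hcpTwoShellPattern) {v w : EuclideanSpace ℝ (Fin 3)} (hv : v ∈ P) (hw : w ∈ P) (hvw : v ≠ w) :
    1 ≤ dist v w := by
  rcases hP with rfl | rfl
  · exact one_le_dist_of_mem_fccTwoShellPattern hv hw hvw
  · exact one_le_dist_of_mem_hcpTwoShellPattern hv hw hvw

/-- Points of either two-shell pattern have norm `≥ 1`. [Literature `norm_of_mem_fcc/hcpTwoShellPattern`] -/
private theorem one_le_norm_of_mem_twoShellPattern {P : Finset (EuclideanSpace ℝ (Fin 3))}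
    (hP : P = fccTwoShellPattern ∨ P = hcpTwoShellPattern) {v : EuclideanSpace ℝ (Fin 3)} (hv : v ∈ P) : 1 ≤ ‖v‖ := by
  have h2 : (1 : ℝ) ≤ Real.sqrt 2 := Real.one_le_sqrt.mpr (by norm_num)
  rcases hP with rfl | rfl
  · rcases norm_of_mem_fccTwoShellPattern hv with h | h <;> rw [h]
    exact h2
  · rcases norm_of_mem_hcpTwoShellPattern hv with h | h <;> rw [h]
    exact h2

/-- Both two-shell patterns contain an ANTIPODAL PAIR `±w` of kissing points (`w = (1, −1, 0)/√2`, a vector of the common hexagonal layer).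
[Literature `fccInt`, `hcpInt`] -/
theorem exists_pm_mem_twoShellPattern {P : Finset (EuclideanSpace ℝ (Fin 3))} (hP : P = fccTwoShellPattern ∨ P = hcpTwoShellPattern) :
    ∃ w : EuclideanSpace ℝ (Fin 3), w ∈ P ∧ -w ∈ P ∧ ‖w‖ = 1 := by
  rcases hP with rfl | rfl
  · have h1 : ((Real.sqrt (2 : ℕ))⁻¹ • intVec ![1, -1, 0] : EuclideanSpace ℝ (Fin 3)) ∈ fccKissingPattern :=
      Finset.mem_image_of_mem _ (by decide)
    have h2 : ((Real.sqrt (2 : ℕ))⁻¹ • intVec ![-1, 1, 0] : EuclideanSpace ℝ (Fin 3)) ∈ fccKissingPattern :=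
      Finset.mem_image_of_mem _ (by decide)
    have e : ((Real.sqrt (2 : ℕ))⁻¹ • intVec ![-1, 1, 0] : EuclideanSpace ℝ (Fin 3)) = -((Real.sqrt (2 : ℕ))⁻¹ • intVec ![1, -1, 0]) := by
      rw [← smul_neg]; congr 1; ext i; fin_cases i <;> simp [intVec]
    exact ⟨_, fccKissingPattern_subset h1, e ▸ fccKissingPattern_subset h2, norm_eq_one_of_mem_fccKissingPattern h1⟩
  · have h1 : ((Real.sqrt (18 : ℕ))⁻¹ • intVec ![3, -3, 0] : EuclideanSpace ℝ (Fin 3)) ∈ hcpKissingPattern :=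
      Finset.mem_image_of_mem _ (by decide)
    have h2 : ((Real.sqrt (18 : ℕ))⁻¹ • intVec ![-3, 3, 0] : EuclideanSpace ℝ (Fin 3)) ∈ hcpKissingPattern :=
      Finset.mem_image_of_mem _ (by decide)
    have e : ((Real.sqrt (18 : ℕ))⁻¹ • intVec ![-3, 3, 0] : EuclideanSpace ℝ (Fin 3)) = -((Real.sqrt (18 : ℕ))⁻¹ • intVec ![3, -3, 0]) := by
      rw [← smul_neg]; congr 1; ext i; fin_cases i <;> simp [intVec]
    exact ⟨_, hcpKissingPattern_subset h1, e ▸ hcpKissingPattern_subset h2, norm_eq_one_of_mem_hcpKissingPattern h1⟩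

/-- In an affine frame (`‖A v − Q v‖ ≤ θ` on the pattern, `Q` a linear isometry) a pattern point keeps norm `≥ 1 − θ`. [this file] -/
theorem one_sub_le_norm_frame {θ : ℝ} {A : EuclideanSpace ℝ (Fin 3) →ₗ[ℝ] EuclideanSpace ℝ (Fin 3)}
    {Q : EuclideanSpace ℝ (Fin 3) →ₗᵢ[ℝ] EuclideanSpace ℝ (Fin 3)} {P : Finset (EuclideanSpace ℝ (Fin 3))}
    (hP : P = fccTwoShellPattern ∨ P = hcpTwoShellPattern) (hA : ∀ v ∈ P, ‖A v - Q v‖ ≤ θ) {v : EuclideanSpace ℝ (Fin 3)} (hv : v ∈ P) :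
    1 - θ ≤ ‖A v‖ := by
  have h1 : 1 ≤ ‖Q v‖ := by rw [Q.norm_map]; exact one_le_norm_of_mem_twoShellPattern hP hv
  have h2 : ‖Q v‖ - ‖A v‖ ≤ ‖Q v - A v‖ := norm_sub_norm_le _ _
  rw [norm_sub_rev] at h2
  linarith [hA v hv]

/-- … and norm `≤ ‖v‖ + θ`. [this file] -/
theorem norm_frame_le {θ : ℝ} {A : EuclideanSpace ℝ (Fin 3) →ₗ[ℝ] EuclideanSpace ℝ (Fin 3)}
    {Q : EuclideanSpace ℝ (Fin 3) →ₗᵢ[ℝ] EuclideanSpace ℝ (Fin 3)} {P : Finset (EuclideanSpace ℝ (Fin 3))}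
    (hA : ∀ v ∈ P, ‖A v - Q v‖ ≤ θ) {v : EuclideanSpace ℝ (Fin 3)} (hv : v ∈ P) :
    ‖A v‖ ≤ ‖v‖ + θ := by
  have h2 : ‖A v‖ - ‖Q v‖ ≤ ‖A v - Q v‖ := norm_sub_norm_le _ _
  rw [Q.norm_map] at h2
  linarith [hA v hv]

/-- The affine image of the pattern is `(1 − 2θ)`-separated. [this file] -/
theorem frame_sep {θ : ℝ} {A : EuclideanSpace ℝ (Fin 3) →ₗ[ℝ] EuclideanSpace ℝ (Fin 3)}
    {Q : EuclideanSpace ℝ (Fin 3) →ₗᵢ[ℝ] EuclideanSpace ℝ (Fin 3)} {P : Finset (EuclideanSpace ℝ (Fin 3))}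
    (hP : P = fccTwoShellPattern ∨ P = hcpTwoShellPattern) (hA : ∀ v ∈ P, ‖A v - Q v‖ ≤ θ) {v w : EuclideanSpace ℝ (Fin 3)}
    (hv : v ∈ P) (hw : w ∈ P) (hvw : v ≠ w) : 1 - 2 * θ ≤ ‖A v - A w‖ := by
  have h1 : 1 ≤ ‖Q v - Q w‖ := by
    rw [← map_sub, Q.norm_map, ← dist_eq_norm]; exact one_le_dist_of_mem_twoShellPattern hP hv hw hvw
  have h2 : ‖Q v - Q w‖ - ‖A v - A w‖ ≤ ‖(Q v - Q w) - (A v - A w)‖ := norm_sub_norm_le _ _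
  have h3 : (Q v - Q w) - (A v - A w) = (A w - Q w) - (A v - Q v) := by abel
  rw [h3] at h2
  have h4 := norm_sub_le (A w - Q w) (A v - Q v)
  linarith [hA v hv, hA w hw]

/-! ## §2  The affine first-shell scale floor (F1′-aff) -/

/-- **(F1′-aff) AFFINE FIRST-SHELL SCALE FLOOR.**  At an affinely framed site `i` (`0 ≤ ε`, `0 ≤ θ`), a site `k ≠ i` at depth `t ≥ 0` inside the
exhaustive radius, `dist (y k) (y i) ≤ (3/2 + g − t)·nn_i`, has `nn_k ≥ min t (1 − 2θ − 2ε)·nn_i`. [this file] -/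
theorem affFirstShell_scale_floor {ε θ g t : ℝ} (hε : 0 ≤ ε) (hθ : 0 ≤ θ) (ht : 0 ≤ t) {y : Fin N → EuclideanSpace ℝ (Fin 3)}
    (hy : Function.Injective y) {i k : Fin N} (hi : AffFramed ε θ g y i) (hki : k ≠ i)
    (hk : dist (y k) (y i) ≤ (3 / 2 + g - t) * nearestDist y i) :
    min t (1 - 2 * θ - 2 * ε) * nearestDist y i ≤ nearestDist y k := by
  obtain ⟨Q, A, P, f, hP, hA, hf, hinj, hex⟩ := hi
  set s := nearestDist y i with hs
  have hnn : 0 ≤ s := nearestDist_nonneg y i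
  have htk : dist (y k) (y i) ≤ (3 / 2 + g) * s := hk.trans (by nlinarith)
  obtain ⟨v, hv, hfv⟩ := hex k hki htk
  have hvk : dist (y k) (y i + s • A v) ≤ ε * s := by have h := (hf v hv).2; rwa [hfv] at h
  have hmin_le : min t (1 - 2 * θ - 2 * ε) * s ≤ (1 - 2 * θ - 2 * ε) * s := mul_le_mul_of_nonneg_right (min_le_right _ _) hnn
  have hmin_le' : min t (1 - 2 * θ - 2 * ε) * s ≤ t * s := mul_le_mul_of_nonneg_right (min_le_left _ _) hnn
  refine le_nearestDist ⟨i, hki.symm⟩ fun j hj => ?_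
  by_cases hji : j = i
  · subst hji
    have hc : dist (y j + s • A v) (y j) = s * ‖A v‖ := by
      rw [dist_eq_norm, add_sub_cancel_left, norm_smul, Real.norm_of_nonneg hnn]
    have htri := dist_triangle (y j + s • A v) (y k) (y j)
    rw [hc, dist_comm (y j + s • A v) (y k)] at htri
    have h1 : s * (1 - θ) ≤ s * ‖A v‖ := mul_le_mul_of_nonneg_left (one_sub_le_norm_frame hP hA hv) hnn
    nlinarith [mul_nonneg hε hnn, mul_nonneg hθ hnn]
  · by_cases hjn : dist (y j) (y i) ≤ (3 / 2 + g) * s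
    · obtain ⟨v', hv', hfv'⟩ := hex j hji hjn
      have hne : v ≠ v' := by rintro rfl; exact hj (hy (hfv'.symm.trans hfv))
      have hvj : dist (y j) (y i + s • A v') ≤ ε * s := by have h := (hf v' hv').2; rwa [hfv'] at h
      have hc : dist (y i + s • A v) (y i + s • A v') = s * ‖A v - A v'‖ := by
        rw [dist_add_left, dist_eq_norm, ← smul_sub, norm_smul, Real.norm_of_nonneg hnn]
      have htri := dist_triangle4 (y i + s • A v) (y k) (y j) (y i + s • A v')
      rw [hc, dist_comm (y i + s • A v) (y k)] at htri
      have h1 : s * (1 - 2 * θ) ≤ s * ‖A v - A v'‖ := mul_le_mul_of_nonneg_left (frame_sep hP hA hv hv' hne) hnn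
      linarith
    · have htri := dist_triangle (y j) (y k) (y i)
      rw [dist_comm (y j) (y k)] at htri; push Not at hjn; linarith

/-! ## §3  One-step scale transfer between adjacent affine frames -/

/-- **Hemisphere inequality.**  If `x_m` is `ε s'`-close to `x_k + s'·A' w'` with `‖A' w' − Q' w'‖ ≤ θ` and `Q' w'` points into the closed
half-space of `x_j − x_k`, then `dist x_m x_j² ≤ dist x_m x_k² + 2(θ + ε)·s'·dist x_k x_j + dist x_k x_j²` (law of cosines with the
cross term controlled from below). [this file] -/
theorem dist_sq_le_of_hemisphere {θ ε s' : ℝ} (hs'0 : 0 ≤ s') {A' : EuclideanSpace ℝ (Fin 3) →ₗ[ℝ] EuclideanSpace ℝ (Fin 3)}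
    {Q' : EuclideanSpace ℝ (Fin 3) →ₗᵢ[ℝ] EuclideanSpace ℝ (Fin 3)} {w' : EuclideanSpace ℝ (Fin 3)} (hθ' : ‖A' w' - Q' w'‖ ≤ θ)
    (xm xk xj : EuclideanSpace ℝ (Fin 3)) (hw'u : 0 ≤ inner ℝ (Q' w') (xj - xk)) (hmd : dist xm (xk + s' • A' w') ≤ ε * s') :
    dist xm xj ^ 2 ≤ dist xm xk ^ 2 + 2 * (θ + ε) * s' * dist xk xj + dist xk xj ^ 2 := by
  set u : EuclideanSpace ℝ (Fin 3) := xj - xk with hu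
  set p : EuclideanSpace ℝ (Fin 3) := xm - xk with hp
  set D := dist xk xj with hD
  have hD0 : 0 ≤ D := dist_nonneg
  have hDu : ‖u‖ = D := by rw [hu, hD, ← dist_eq_norm, dist_comm]
  have h1 : dist xm xj = ‖p - u‖ := by rw [hp, hu, dist_eq_norm]; congr 1; abel
  have h2 : dist xm xk = ‖p‖ := by rw [hp, dist_eq_norm]
  rw [h1, norm_sub_sq_real, h2, hDu]
  have i1 : -(θ * D) ≤ inner ℝ (A' w') u := by
    have e2 : A' w' = Q' w' + (A' w' - Q' w') := by abel
    rw [e2, inner_add_left]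
    have hb := abs_real_inner_le_norm (A' w' - Q' w') u; rw [hDu] at hb
    nlinarith [norm_nonneg (A' w' - Q' w'), (abs_le.mp hb).1]
  have i2 : -(ε * s' * D) ≤ inner ℝ (p - s' • A' w') u := by
    have hn : ‖p - s' • A' w'‖ ≤ ε * s' := by
      have e : p - s' • A' w' = xm - (xk + s' • A' w') := by rw [hp]; abel
      rw [e, ← dist_eq_norm]; exact hmd
    have hb := abs_real_inner_le_norm (p - s' • A' w') u; rw [hDu] at hb
    nlinarith [norm_nonneg (p - s' • A' w'), (abs_le.mp hb).1]
  have e1 : p = s' • A' w' + (p - s' • A' w') := by abel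
  have i3 : -((θ + ε) * s' * D) ≤ inner ℝ p u := by
    rw [e1, inner_add_left, real_inner_smul_left]
    nlinarith [mul_le_mul_of_nonneg_left i1 hs'0]
  linarith

/-- **ONE-STEP SCALE TRANSFER.**  Two affinely framed sites `j`, `k ≠ j` (`0 ≤ ε`, `0 ≤ θ`, `θ + ε ≤ 1/50`, `0 ≤ g`) with
`dist (y k) (y j) ≤ (1 + θ + ε)·nn_j` have comparable scales: `(1 − 2θ − 2ε)/(1 + θ + ε)·nn_j ≤ nn_k`.  (Hemisphere trick, see the module
docstring.) [this file] -/
theorem affFramed_scale_transfer {ε θ g : ℝ} (hε : 0 ≤ ε) (hθ : 0 ≤ θ) (hg : 0 ≤ g) (ht : θ + ε ≤ 1 / 50)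
    {y : Fin N → EuclideanSpace ℝ (Fin 3)} (hy : Function.Injective y) {j k : Fin N}
    (hj : AffFramed ε θ g y j) (hk : AffFramed ε θ g y k) (hkj : k ≠ j)
    (hd : dist (y k) (y j) ≤ (1 + θ + ε) * nearestDist y j) :
    (1 - 2 * θ - 2 * ε) / (1 + θ + ε) * nearestDist y j ≤ nearestDist y k := by
  obtain ⟨Q, A, P, f, hP, hA, hf, hinj, hex⟩ := hj
  obtain ⟨Q', A', P', f', hP', hA', hf', hinj', hex'⟩ := hk
  set s := nearestDist y j with hs
  set s' := nearestDist y k with hs'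
  set D := dist (y k) (y j) with hD
  have hs0 : 0 ≤ s := nearestDist_nonneg y j
  have hs'0 : 0 ≤ s' := nearestDist_nonneg y k
  have hD0 : 0 ≤ D := dist_nonneg
  have hsD : s ≤ D := by rw [hD, dist_comm]; exact nearestDist_le_dist y hkj
  have hs'D : s' ≤ D := nearestDist_le_dist y (Ne.symm hkj)
  have ht1 : 0 < 1 + θ + ε := by linarith
  rw [div_mul_eq_mul_div, div_le_iff₀ ht1]
  -- `nn_k > 0`
  have hs'pos : 0 < s' := by
    obtain ⟨m₀, hm₀, he⟩ := exists_nearestDist_eq_dist y ⟨j, Ne.symm hkj⟩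
    rw [hs', he]
    exact dist_pos.mpr fun h => hm₀ (hy h).symm
  -- the hemisphere point of `k`'s frame
  obtain ⟨w, hwP, hwneg, hw1⟩ := exists_pm_mem_twoShellPattern hP'
  set u : EuclideanSpace ℝ (Fin 3) := y j - y k with hu
  obtain ⟨w', hw'P, hw'1, hw'u⟩ : ∃ w' : EuclideanSpace ℝ (Fin 3), w' ∈ P' ∧ ‖w'‖ = 1 ∧ 0 ≤ inner ℝ (Q' w') u := by
    by_cases h0 : 0 ≤ inner ℝ (Q' w) u
    · exact ⟨w, hwP, hw1, h0⟩
    · exact ⟨-w, hwneg, by rw [norm_neg, hw1], by rw [map_neg, inner_neg_left]; linarith⟩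
  obtain ⟨⟨m, hym⟩, hmd⟩ := hf' w' hw'P
  rw [← hym] at hmd
  set r := dist (y m) (y k) with hr
  have hAw_le : ‖A' w'‖ ≤ 1 + θ := by have h := norm_frame_le hA' hw'P; rwa [hw'1] at h
  have hAw_ge : 1 - θ ≤ ‖A' w'‖ := one_sub_le_norm_frame hP' hA' hw'P
  have hc' : dist (y k + s' • A' w') (y k) = s' * ‖A' w'‖ := by
    rw [dist_eq_norm, add_sub_cancel_left, norm_smul, Real.norm_of_nonneg hs'0]
  have hr_le : r ≤ (1 + θ + ε) * s' := by
    have htri := dist_triangle (y m) (y k + s' • A' w') (y k)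
    rw [hc'] at htri
    nlinarith [mul_le_mul_of_nonneg_left hAw_le hs'0]
  have hr_ge : (1 - θ - ε) * s' ≤ r := by
    have htri := dist_triangle (y k + s' • A' w') (y m) (y k)
    rw [hc', dist_comm (y k + s' • A' w') (y m)] at htri
    nlinarith [mul_le_mul_of_nonneg_left hAw_ge hs'0]
  -- KEY (hemisphere inequality): `dist (y m) (y j)² ≤ r² + 2(θ+ε)·s'·D + D²`
  have hkey : dist (y m) (y j) ^ 2 ≤ r ^ 2 + 2 * (θ + ε) * s' * D + D ^ 2 := by
    have h := dist_sq_le_of_hemisphere hs'0 (hA' w' hw'P) (y m) (y k) (y j) (by rwa [hu] at hw'u) hmd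
    rwa [← hr, ← hD] at h
  by_cases hmj : m = j
  · -- `j` itself is the hemisphere point: `D = r ≤ (1 + θ + ε)·nn_k`
    have hrD : r = D := by rw [hr, hmj, hD, dist_comm]
    have h2 : 0 ≤ (2 * θ + 2 * ε) * s := mul_nonneg (by linarith) hs0
    nlinarith
  · -- `m ≠ j`: `m` lies within `3/2·nn_j` of `j`, hence is a point of `j`'s frame
    have hmj_dist : dist (y m) (y j) ≤ (3 / 2 + g) * s := by
      have hsq : dist (y m) (y j) ^ 2 ≤ (3 / 2 * s) ^ 2 := by
        have hte : 0 ≤ θ + ε := by linarith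
        have h51 : (1 + θ + ε) ≤ 51 / 50 := by linarith
        have hr0 : 0 ≤ r := dist_nonneg
        have hr51 : r ≤ 51 / 50 * D :=
          calc r ≤ (1 + θ + ε) * s' := hr_le
            _ ≤ (1 + θ + ε) * D := mul_le_mul_of_nonneg_left hs'D ht1.le
            _ ≤ 51 / 50 * D := mul_le_mul_of_nonneg_right h51 hD0
        have hD51 : D ≤ 51 / 50 * s := hd.trans (mul_le_mul_of_nonneg_right h51 hs0)
        have hr2 : r ^ 2 ≤ 2601 / 2500 * D ^ 2 := by
          have h := pow_le_pow_left₀ hr0 hr51 2; rw [mul_pow] at h; norm_num at h; exact h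
        have hD2 : D ^ 2 ≤ 2601 / 2500 * s ^ 2 := by
          have h := pow_le_pow_left₀ hD0 hD51 2; rw [mul_pow] at h; norm_num at h; exact h
        have hsD' : s' * D ≤ D ^ 2 := by rw [sq]; exact mul_le_mul_of_nonneg_right hs'D hD0
        have hsd0 : 0 ≤ s' * D := mul_nonneg hs'0 hD0
        have h2 : 2 * (θ + ε) * s' * D ≤ 1 / 25 * D ^ 2 := by
          have h3 : 2 * (θ + ε) * (s' * D) ≤ 1 / 25 * (s' * D) := mul_le_mul_of_nonneg_right (by linarith) hsd0
          have h4 : 1 / 25 * (s' * D) ≤ 1 / 25 * D ^ 2 := by linarith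
          linarith [h3, h4, show 2 * (θ + ε) * s' * D = 2 * (θ + ε) * (s' * D) by ring]
        calc dist (y m) (y j) ^ 2 ≤ 9 / 4 * s ^ 2 := by linarith [hkey, hr2, hD2, h2, sq_nonneg D, sq_nonneg s]
          _ = (3 / 2 * s) ^ 2 := by ring
      have h := (pow_le_pow_iff_left₀ dist_nonneg (by positivity : (0 : ℝ) ≤ 3 / 2 * s) two_ne_zero).mp hsq
      linarith [mul_nonneg hg hs0]
    obtain ⟨v, hv, hfv⟩ := hex m hmj hmj_dist
    have hkj_dist : dist (y k) (y j) ≤ (3 / 2 + g) * s := hd.trans (mul_le_mul_of_nonneg_right (by linarith) hs0)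
    obtain ⟨vk, hvk, hfvk⟩ := hex k hkj hkj_dist
    have hmk : m ≠ k := by
      intro hmk; have h0 : r = 0 := by rw [hr, hmk, dist_self]
      linarith [mul_pos (by linarith : (0 : ℝ) < 1 - θ - ε) hs'pos]
    have hne : v ≠ vk := by rintro rfl; exact hmk (hy (hfv.symm.trans hfvk))
    have hvm : dist (y m) (y j + s • A v) ≤ ε * s := by have h := (hf v hv).2; rwa [hfv] at h
    have hvk' : dist (y k) (y j + s • A vk) ≤ ε * s := by have h := (hf vk hvk).2; rwa [hfvk] at h
    have hsep : 1 - 2 * θ ≤ ‖A v - A vk‖ := frame_sep hP hA hv hvk hne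
    have hc : dist (y j + s • A v) (y j + s • A vk) = s * ‖A v - A vk‖ := by
      rw [dist_add_left, dist_eq_norm, ← smul_sub, norm_smul, Real.norm_of_nonneg hs0]
    have htri := dist_triangle4 (y j + s • A v) (y m) (y k) (y j + s • A vk)
    rw [hc, dist_comm (y j + s • A v) (y m)] at htri
    have h1 : s * (1 - 2 * θ) ≤ s * ‖A v - A vk‖ := mul_le_mul_of_nonneg_left hsep hs0
    linarith

/-- The trivial other direction: `nn_k ≤ dist (y k) (y j) ≤ (1 + θ + ε)·nn_j`. [this file] -/
theorem nearestDist_le_of_dist_le {c : ℝ} {y : Fin N → EuclideanSpace ℝ (Fin 3)} {j k : Fin N} (hkj : k ≠ j)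
    (hd : dist (y k) (y j) ≤ c * nearestDist y j) : nearestDist y k ≤ c * nearestDist y j :=
  (nearestDist_le_dist y (Ne.symm hkj)).trans hd

/-- **Record instance** at the node's affine literals `(ε, θ, g) = (10⁻⁴, 10⁻³, 1/450)`: one step out along a first-shell bond the scale drops by
at most the factor `9967/10000` (`(1 − 0.0022)/(1.0011) = 0.99670…`). [this file] -/
theorem affFramed_scale_transfer_record {y : Fin N → EuclideanSpace ℝ (Fin 3)} (hy : Function.Injective y) {j k : Fin N}
    (hj : AffFramed (1 / 10 ^ 4) (1 / 1000) (1 / 450) y j) (hk : AffFramed (1 / 10 ^ 4) (1 / 1000) (1 / 450) y k) (hkj : k ≠ j)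
    (hd : dist (y k) (y j) ≤ (1 + 1 / 1000 + 1 / 10 ^ 4) * nearestDist y j) :
    9967 / 10000 * nearestDist y j ≤ nearestDist y k := by
  have h := affFramed_scale_transfer (ε := 1 / 10 ^ 4) (θ := 1 / 1000) (g := 1 / 450) (by norm_num) (by norm_num) (by norm_num)
    (by norm_num) hy hj hk hkj hd
  have e : (9967 / 10000 : ℝ) ≤ (1 - 2 * (1 / 1000) - 2 * (1 / 10 ^ 4)) / (1 + 1 / 1000 + 1 / 10 ^ 4) := by norm_num
  nlinarith [nearestDist_nonneg y j]

/-- **Record instance of (F1′-aff)**: a site within `53/50·nn_i` of an affinely `(10⁻⁴, 10⁻³, 1/450)`-framed site has `nn_k ≥ 11/25·nn_i`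
(so NODE g79's `scaleWeight` is never `0` on such a pair). [this file] -/
theorem affFirstShell_scale_floor_record {y : Fin N → EuclideanSpace ℝ (Fin 3)} (hy : Function.Injective y) {i k : Fin N}
    (hi : AffFramed (1 / 10 ^ 4) (1 / 1000) (1 / 450) y i) (hki : k ≠ i) (hk : dist (y k) (y i) ≤ 53 / 50 * nearestDist y i) :
    11 / 25 * nearestDist y i ≤ nearestDist y k := by
  have h := affFirstShell_scale_floor (ε := 1 / 10 ^ 4) (θ := 1 / 1000) (g := 1 / 450) (t := 11 / 25) (by norm_num) (by norm_num)
    (by norm_num) hy hi hki (hk.trans (mul_le_mul_of_nonneg_right (by norm_num) (nearestDist_nonneg y i)))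
  have e : min (11 / 25 : ℝ) (1 - 2 * (1 / 1000) - 2 * (1 / 10 ^ 4)) = 11 / 25 := by norm_num
  rwa [e] at h

/-! ## §4  Scale coherence along first-shell chains -/

/-- **SCALE COHERENCE ALONG A FIRST-SHELL CHAIN.**  If `j :: l` is a chain of affinely framed sites in which each site lies within
`(1 + θ + ε)·nn` of its predecessor (and differs from it), then every site `k` of `l` has `nn_k ≥ λ^{|l|}·nn_j` with
`λ = (1 − 2θ − 2ε)/(1 + θ + ε)` (iterate `affFramed_scale_transfer`; `λ ≤ 1` makes the exponent uniform). [this file] -/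
theorem affFramed_scale_chain {ε θ g : ℝ} (hε : 0 ≤ ε) (hθ : 0 ≤ θ) (hg : 0 ≤ g) (ht : θ + ε ≤ 1 / 50)
    {y : Fin N → EuclideanSpace ℝ (Fin 3)} (hy : Function.Injective y) (l : List (Fin N)) (j : Fin N)
    (hfr : ∀ k ∈ j :: l, AffFramed ε θ g y k)
    (hch : List.IsChain (fun a b => b ≠ a ∧ dist (y b) (y a) ≤ (1 + θ + ε) * nearestDist y a) (j :: l)) :
    ∀ k ∈ l, ((1 - 2 * θ - 2 * ε) / (1 + θ + ε)) ^ l.length * nearestDist y j ≤ nearestDist y k := by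
  have hl0 : 0 ≤ (1 - 2 * θ - 2 * ε) / (1 + θ + ε) := div_nonneg (by linarith) (by linarith)
  have hl1 : (1 - 2 * θ - 2 * ε) / (1 + θ + ε) ≤ 1 := by
    rw [div_le_one (by linarith)]
    linarith
  induction l generalizing j with
  | nil => intro k hk; simp at hk
  | cons k' l' ih =>
    intro k hk
    replace hch := List.isChain_cons_cons.mp hch
    have hstep : (1 - 2 * θ - 2 * ε) / (1 + θ + ε) * nearestDist y j ≤ nearestDist y k' :=
      affFramed_scale_transfer hε hθ hg ht hy (hfr j (by simp)) (hfr k' (by simp)) hch.1.1 hch.1.2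
    have hfr' : ∀ k ∈ k' :: l', AffFramed ε θ g y k := fun k hk => hfr k (List.mem_cons_of_mem _ hk)
    have hpow : ((1 - 2 * θ - 2 * ε) / (1 + θ + ε)) ^ (k' :: l').length * nearestDist y j
        = ((1 - 2 * θ - 2 * ε) / (1 + θ + ε)) ^ l'.length * ((1 - 2 * θ - 2 * ε) / (1 + θ + ε) * nearestDist y j) := by
      rw [List.length_cons, pow_succ]; ring
    rw [hpow]
    have hpl : 0 ≤ ((1 - 2 * θ - 2 * ε) / (1 + θ + ε)) ^ l'.length := pow_nonneg hl0 _
    rcases List.mem_cons.mp hk with rfl | hk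
    · have hpl1 : ((1 - 2 * θ - 2 * ε) / (1 + θ + ε)) ^ l'.length ≤ 1 := pow_le_one₀ hl0 hl1
      have hnn : 0 ≤ nearestDist y k := nearestDist_nonneg y k
      calc ((1 - 2 * θ - 2 * ε) / (1 + θ + ε)) ^ l'.length * ((1 - 2 * θ - 2 * ε) / (1 + θ + ε) * nearestDist y j)
          ≤ ((1 - 2 * θ - 2 * ε) / (1 + θ + ε)) ^ l'.length * nearestDist y k := mul_le_mul_of_nonneg_left hstep hpl
        _ ≤ 1 * nearestDist y k := mul_le_mul_of_nonneg_right hpl1 hnn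
        _ = nearestDist y k := one_mul _
    · calc ((1 - 2 * θ - 2 * ε) / (1 + θ + ε)) ^ l'.length * ((1 - 2 * θ - 2 * ε) / (1 + θ + ε) * nearestDist y j)
          ≤ ((1 - 2 * θ - 2 * ε) / (1 + θ + ε)) ^ l'.length * nearestDist y k' := mul_le_mul_of_nonneg_left hstep hpl
        _ ≤ nearestDist y k := ih k' hfr' hch.2 k hk

/-- … and the easy upper bound along the same chain: `nn_k ≤ (1 + θ + ε)^{|l|}·nn_j`. [this file] -/
theorem affFramed_scale_chain_le {ε θ : ℝ} (hε : 0 ≤ ε) (hθ : 0 ≤ θ) {y : Fin N → EuclideanSpace ℝ (Fin 3)} (l : List (Fin N))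
    (j : Fin N) (hch : List.IsChain (fun a b => b ≠ a ∧ dist (y b) (y a) ≤ (1 + θ + ε) * nearestDist y a) (j :: l)) :
    ∀ k ∈ l, nearestDist y k ≤ (1 + θ + ε) ^ l.length * nearestDist y j := by
  have hl1 : (1 : ℝ) ≤ 1 + θ + ε := by linarith
  induction l generalizing j with
  | nil => intro k hk; simp at hk
  | cons k' l' ih =>
    intro k hk
    replace hch := List.isChain_cons_cons.mp hch
    have hstep : nearestDist y k' ≤ (1 + θ + ε) * nearestDist y j := nearestDist_le_of_dist_le hch.1.1 hch.1.2
    have hpl : (0 : ℝ) ≤ (1 + θ + ε) ^ l'.length := pow_nonneg (by linarith) _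
    have hpow : (1 + θ + ε) ^ (k' :: l').length * nearestDist y j = (1 + θ + ε) ^ l'.length * ((1 + θ + ε) * nearestDist y j) := by
      rw [List.length_cons, pow_succ]; ring
    rw [hpow]
    rcases List.mem_cons.mp hk with rfl | hk
    · have hpl1 : (1 : ℝ) ≤ (1 + θ + ε) ^ l'.length := one_le_pow₀ hl1
      have hnn : 0 ≤ nearestDist y k := nearestDist_nonneg y k
      calc nearestDist y k = 1 * nearestDist y k := (one_mul _).symm
        _ ≤ (1 + θ + ε) ^ l'.length * nearestDist y k := mul_le_mul_of_nonneg_right hpl1 hnn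
        _ ≤ (1 + θ + ε) ^ l'.length * ((1 + θ + ε) * nearestDist y j) := mul_le_mul_of_nonneg_left hstep hpl
    · calc nearestDist y k ≤ (1 + θ + ε) ^ l'.length * nearestDist y k' := ih k' hch.2 k hk
        _ ≤ (1 + θ + ε) ^ l'.length * ((1 + θ + ε) * nearestDist y j) := mul_le_mul_of_nonneg_left hstep hpl

/-- **Record instance**: along a first-shell chain of at most `16` affinely `(10⁻⁴, 10⁻³, 1/450)`-framed sites every scale stays in
`[237/250, 211/200]·nn_j = [0.948, 1.055]·nn_j` (`(9967/10⁴)¹⁶ = 0.9485`, `(1.0011)¹⁶ = 1.0177 ≤ 1.055`). [this file] -/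
theorem affFramed_scale_chain_record {y : Fin N → EuclideanSpace ℝ (Fin 3)} (hy : Function.Injective y) (l : List (Fin N)) (j : Fin N)
    (hl : l.length ≤ 16) (hfr : ∀ k ∈ j :: l, AffFramed (1 / 10 ^ 4) (1 / 1000) (1 / 450) y k)
    (hch : List.IsChain (fun a b => b ≠ a ∧ dist (y b) (y a) ≤ (1 + 1 / 1000 + 1 / 10 ^ 4) * nearestDist y a) (j :: l)) :
    ∀ k ∈ l, 237 / 250 * nearestDist y j ≤ nearestDist y k ∧ nearestDist y k ≤ 211 / 200 * nearestDist y j := by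
  intro k hk
  have hnn : 0 ≤ nearestDist y j := nearestDist_nonneg y j
  have h1 := affFramed_scale_chain (ε := 1 / 10 ^ 4) (θ := 1 / 1000) (g := 1 / 450) (by norm_num) (by norm_num) (by norm_num)
    (by norm_num) hy l j hfr hch k hk
  have h2 := affFramed_scale_chain_le (ε := 1 / 10 ^ 4) (θ := 1 / 1000) (by norm_num) (by norm_num) l j hch k hk
  have e1 : (237 / 250 : ℝ) ≤ ((1 - 2 * (1 / 1000) - 2 * (1 / 10 ^ 4)) / (1 + 1 / 1000 + 1 / 10 ^ 4)) ^ l.length := by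
    have h16 : ((1 - 2 * (1 / 1000) - 2 * (1 / 10 ^ 4)) / (1 + 1 / 1000 + 1 / 10 ^ 4) : ℝ) ^ 16
        ≤ ((1 - 2 * (1 / 1000) - 2 * (1 / 10 ^ 4)) / (1 + 1 / 1000 + 1 / 10 ^ 4)) ^ l.length :=
      pow_le_pow_of_le_one (by norm_num) (by norm_num) hl
    exact le_trans (by norm_num) h16
  have e2 : ((1 + 1 / 1000 + 1 / 10 ^ 4 : ℝ)) ^ l.length ≤ 211 / 200 := by
    have h16 : ((1 + 1 / 1000 + 1 / 10 ^ 4 : ℝ)) ^ l.length ≤ (1 + 1 / 1000 + 1 / 10 ^ 4) ^ 16 :=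
      pow_le_pow_right₀ (by norm_num) hl
    exact h16.trans (by norm_num)
  exact ⟨le_trans (mul_le_mul_of_nonneg_right e1 hnn) h1, h2.trans (mul_le_mul_of_nonneg_right e2 hnn)⟩

end Summit.AtomisticToContinuum.Crystallization.Theorems.OverbindingBudgetAffineCompressedCutScale
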